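import Mathlib
import Summits.MatrixMultiplication.MatrixMultiplication.Theses.ThinBlockAlpha
import Summits.MatrixMultiplication.MatrixMultiplication.Theorems.ThinPackings.Negative.TriageRuledGraphPatternedArc
import Summits.MatrixMultiplication.MatrixMultiplication.Theorems.ThinBlockAlphaThinPackingsStubDeborderingPower
import Summits.MatrixMultiplication.MatrixMultiplication.Theorems.ThinBlockAlphaThinPackingsStubBoxFreiman
import Summits.MatrixMultiplication.MatrixMultiplication.Theorems.ThinBlockAlphaThinPackingsStubGeneralBridge

/-!
# `ThinPackings` (crux stmt-MatrixMultiplication-10595, route `ThinBlockAlpha`):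
`GeneralFrameDesigns → ThinPackings` by POTENTIAL TAGGING — an explicit, elementary de-bordering

The registered stub `thinPackings_of_generalFrameDesigns` (siege k14, variation "explicit / elementary"),
proved here by a de-bordering mechanism different from the popular-weight-class pigeonhole of
`Theorems/ThinBlockAlphaThinPackingsDebordering.lean`:

* **Potential tagging** (`isSTPP_taggedPower`, `exists_isSTPP_tagged`).  Let `(A i, B i, C i)_{i<L}` be
  LABEL-WEIGHTED STPP (`Triage2.IsLabelWeightedSTPP A B C κ μ`) in an abelian group `H` with integer
  potentials `|κ|, |μ| ≤ R`.  For a word `w : Fin n → Fin L` put the product blocks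
  `A_w × {Σₜ κ (w t)}`, `B_w × {0}`, `C_w × {−Σₜ μ (w t)}` in `(Fin n → H) × ZMod q` with ANY `q > 4nR`.
  A relation `(s' − s) + (t' − t) + (u' − u) = 0` among blocks `x, y, z` then reads, in the tag
  coordinate, `(Σκ_x − Σκ_z) + (Σμ_y − Σμ_z) ≡ 0 (mod q)`; this integer has absolute value `≤ 4nR < q`,
  so it vanishes: the TOTAL WEIGHT of the relation is `0`.  Coordinatewise every weight
  `(κ (x l) − κ (z l)) + (μ (y l) − μ (z l))` is `≥ 1` off the diagonal (clause (5)) and `0` on it, so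
  every coordinate is diagonal, `x = y = z`, and clause (4) (TPP of each block) finishes.  ALL `Lⁿ`
  words are kept (no pigeonhole, no discarded block); the price is the factor `q = 4nR + 1` in `|H|`
  instead of `(2nR+1)²` in `L`.
* **Explicit exponent** (`exists_tagModulus_le_pow`): with `r = N^{η/2} > 1` and
  `n = 2(⌈8R/(r−1)²⌉ + 1)`, Bernoulli's inequality squared gives `4nR + 1 ≤ rⁿ`.
* **Assembly** (`thinPackings_of_generalFrameDesigns`): take the frame design at slack `η/2`; frames with
  order-compatible potentials are label-weighted (`stub_generalBridge`, p81634); reduction modulo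
  `6b + 1 > 6b` keeps that and the cardinalities (`stub_boxFreiman`, p79988); tag the `n`-th power.  The
  final witness is completely explicit: the group `(Fin n → Fin D → ZMod (6b+1)) × ZMod (4nR+1)` and the
  `Lⁿ` tagged product blocks `⟨Nⁿ, Mⁿ, Nⁿ⟩`, with
  `(6b+1)^{Dn} (4nR+1) ≤ Lⁿ N^{n(2+η/2)} N^{nη/2} = Lⁿ (Nⁿ)^{2+η}`.

Prover siege seat k14 (prover-siege-stmt-MatrixMultiplication-10595-thinPackings_of_ge-14-0), 2026-08-16.
-/

-- the tree's namespace `Summit.MatrixMultiplication.MatrixMultiplication.…` repeats a component by design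
set_option linter.dupNamespace false

namespace Summit.MatrixMultiplication.MatrixMultiplication.Theorems.ThinPackings.Tagged

open Finset
open Literature.Computability.AlgebraicComplexity (IsSTPP)
open Summit.MatrixMultiplication.MatrixMultiplication.Theses.ThinBlockAlpha (ThinPackings)
open Summit.MatrixMultiplication.MatrixMultiplication.Theorems.ThinPackings.Negative.Triage2
  (IsLabelWeightedSTPP)

/-- An integer of absolute value `< q` that vanishes modulo `q` is zero. [folklore] -/
theorem int_eq_zero_of_zmod_eq_zero {q : ℕ} {z : ℤ} (hz : (z : ZMod q) = 0) (hlt : |z| < (q : ℤ)) :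
    z = 0 :=
  Int.eq_zero_of_abs_lt_dvd ((ZMod.intCast_zmod_eq_zero_iff_dvd z q).1 hz) hlt

/-- **Potential tagging.**  For a label-weighted STPP family `(A, B, C, κ, μ)` in `H` with potentials
bounded by `R`, any modulus `q > 4nR` and any injective family of words `e : Fin L' → (Fin n → Fin L)`,
the tagged product blocks `(∏ₜ A (e x t)) × {Σₜ κ (e x t)}`, `(∏ₜ B (e x t)) × {0}`,
`(∏ₜ C (e x t)) × {−Σₜ μ (e x t)}` form a genuine `IsSTPP` family in `(Fin n → H) × ZMod q`: the tag
coordinate of a relation is its total weight, an integer of absolute value `≤ 4nR`, hence `0`; all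
coordinate weights are `≥ 0` and vanish only on the diagonal. [new, elementary] -/
theorem isSTPP_taggedPower {H : Type*} [AddCommGroup H] {L n L' R q : ℕ}
    {A B C : Fin L → Finset H} {κ μ : Fin L → ℤ} (hW : IsLabelWeightedSTPP A B C κ μ)
    (hR : ∀ i, |κ i| ≤ R ∧ |μ i| ≤ R) (hq : 4 * n * R < q)
    (e : Fin L' → (Fin n → Fin L)) (he : Function.Injective e) :
    IsSTPP
      (fun x => (Fintype.piFinset fun t => A (e x t)) ×ˢ
        ({(((∑ t, κ (e x t) : ℤ)) : ZMod q)} : Finset (ZMod q)))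
      (fun x => (Fintype.piFinset fun t => B (e x t)) ×ˢ ({(0 : ZMod q)} : Finset (ZMod q)))
      (fun x => (Fintype.piFinset fun t => C (e x t)) ×ˢ
        ({-(((∑ t, μ (e x t) : ℤ)) : ZMod q)} : Finset (ZMod q))) := by
  obtain ⟨-, -, -, hT, hX⟩ := hW
  intro x y z s hs s' hs' t ht t' ht' u hu u' hu' hrel
  simp only [Finset.mem_product, Fintype.mem_piFinset, Finset.mem_singleton] at hs hs' ht ht' hu hu'
  obtain ⟨hs1, hs2⟩ := hs
  obtain ⟨hs'1, hs'2⟩ := hs'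
  obtain ⟨ht1, ht2⟩ := ht
  obtain ⟨ht'1, ht'2⟩ := ht'
  obtain ⟨hu1, hu2⟩ := hu
  obtain ⟨hu'1, hu'2⟩ := hu'
  have hrel1 : ∀ l, (s'.1 l - s.1 l) + (t'.1 l - t.1 l) + (u'.1 l - u.1 l) = 0 := fun l => by
    have h := congr_fun (congr_arg Prod.fst hrel) l
    simpa using h
  have hrel2 : (s'.2 - s.2) + (t'.2 - t.2) + (u'.2 - u.2) = 0 := by
    simpa using congr_arg Prod.snd hrel
  -- the total weight of the relation, read off the tag coordinate
  have hZ : ∑ l, ((κ (e x l) - κ (e z l)) + (μ (e y l) - μ (e z l))) =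
      ((∑ l, κ (e x l)) - ∑ l, κ (e z l)) + ((∑ l, μ (e y l)) - ∑ l, μ (e z l)) := by
    simp only [Finset.sum_add_distrib, Finset.sum_sub_distrib]
  have hZmod : (((∑ l, ((κ (e x l) - κ (e z l)) + (μ (e y l) - μ (e z l))) : ℤ)) : ZMod q) = 0 := by
    have h : (((∑ l, ((κ (e x l) - κ (e z l)) + (μ (e y l) - μ (e z l))) : ℤ)) : ZMod q) =
        (s'.2 - s.2) + (t'.2 - t.2) + (u'.2 - u.2) := by
      rw [hZ, hs2, hs'2, ht2, ht'2, hu2, hu'2]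
      push_cast
      ring
    rw [h, hrel2]
  have hZabs : |∑ l, ((κ (e x l) - κ (e z l)) + (μ (e y l) - μ (e z l)))| < (q : ℤ) := by
    have h1 := abs_sum_label_le κ (fun i => (hR i).1) (e x)
    have h2 := abs_sum_label_le κ (fun i => (hR i).1) (e z)
    have h3 := abs_sum_label_le μ (fun i => (hR i).2) (e y)
    have h4 := abs_sum_label_le μ (fun i => (hR i).2) (e z)
    have hq' : ((4 * n * R : ℕ) : ℤ) < q := by exact_mod_cast hq
    rw [hZ]
    calc |((∑ l, κ (e x l)) - ∑ l, κ (e z l)) + ((∑ l, μ (e y l)) - ∑ l, μ (e z l))|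
        ≤ |(∑ l, κ (e x l)) - ∑ l, κ (e z l)| + |(∑ l, μ (e y l)) - ∑ l, μ (e z l)| :=
          abs_add_le _ _
      _ ≤ (|∑ l, κ (e x l)| + |∑ l, κ (e z l)|) + (|∑ l, μ (e y l)| + |∑ l, μ (e z l)|) :=
          add_le_add (abs_sub _ _) (abs_sub _ _)
      _ ≤ ((n : ℤ) * R + (n : ℤ) * R) + ((n : ℤ) * R + (n : ℤ) * R) :=
          add_le_add (add_le_add h1 h2) (add_le_add h3 h4)
      _ = ((4 * n * R : ℕ) : ℤ) := by push_cast; ring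
      _ < q := hq'
  have hZ0 : ∑ l, ((κ (e x l) - κ (e z l)) + (μ (e y l) - μ (e z l))) = 0 :=
    int_eq_zero_of_zmod_eq_zero hZmod hZabs
  -- every coordinate weight is `≥ 0`, and `= 0` only on the diagonal
  have hclaim : ∀ l, 0 ≤ (κ (e x l) - κ (e z l)) + (μ (e y l) - μ (e z l)) ∧
      ((κ (e x l) - κ (e z l)) + (μ (e y l) - μ (e z l)) = 0 → e x l = e y l ∧ e y l = e z l) := by
    intro l
    by_cases hdiag : e x l = e y l ∧ e y l = e z l
    · refine ⟨?_, fun _ => hdiag⟩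
      rw [hdiag.1, hdiag.2, sub_self, sub_self, add_zero]
    · have h1 : 1 ≤ (κ (e x l) - κ (e z l)) + (μ (e y l) - μ (e z l)) :=
        hX (e x l) (e y l) (e z l) hdiag (s.1 l) (hs1 l) (s'.1 l) (hs'1 l) (t.1 l) (ht1 l)
          (t'.1 l) (ht'1 l) (u.1 l) (hu1 l) (u'.1 l) (hu'1 l) (hrel1 l)
      exact ⟨by omega, fun h0 => by omega⟩
  have hall : ∀ l, e x l = e y l ∧ e y l = e z l := by
    have h0 := (Finset.sum_eq_zero_iff_of_nonneg (fun l _ => (hclaim l).1)).1 hZ0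
    exact fun l => (hclaim l).2 (h0 l (Finset.mem_univ l))
  have hxy : x = y := he (funext fun l => (hall l).1)
  have hyz : y = z := he (funext fun l => (hall l).2)
  subst hxy
  subst hyz
  have hcoord : ∀ l, s.1 l = s'.1 l ∧ t.1 l = t'.1 l ∧ u.1 l = u'.1 l := fun l =>
    hT _ (s.1 l) (hs1 l) (s'.1 l) (hs'1 l) (t.1 l) (ht1 l) (t'.1 l) (ht'1 l) (u.1 l) (hu1 l)
      (u'.1 l) (hu'1 l) (hrel1 l)
  refine ⟨rfl, rfl, ?_, ?_, ?_⟩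
  · exact Prod.ext (funext fun l => (hcoord l).1) (by rw [hs2, hs'2])
  · exact Prod.ext (funext fun l => (hcoord l).2.1) (by rw [ht2, ht'2])
  · exact Prod.ext (funext fun l => (hcoord l).2.2) (by rw [hu2, hu'2])

/-- **Tagged powers, packaged.**  A label-weighted STPP family of `L` blocks `⟨N, M, N⟩` in `H` with
potentials in `[-R, R]` yields, for every `n` and every modulus `q > 4nR`, a genuine `IsSTPP` family of
ALL `Lⁿ` tagged product blocks `⟨Nⁿ, Mⁿ, Nⁿ⟩` in `(Fin n → H) × ZMod q` (words enumerated by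
`finFunctionFinEquiv`). [new, elementary] -/
theorem exists_isSTPP_tagged {H : Type*} [AddCommGroup H] {L N M R : ℕ}
    {A B C : Fin L → Finset H} {κ μ : Fin L → ℤ} (hW : IsLabelWeightedSTPP A B C κ μ)
    (hc : ∀ i, (A i).card = N ∧ (B i).card = M ∧ (C i).card = N)
    (hR : ∀ i, |κ i| ≤ R ∧ |μ i| ≤ R) (n : ℕ) {q : ℕ} (hq : 4 * n * R < q) :
    ∃ (A' B' C' : Fin (L ^ n) → Finset ((Fin n → H) × ZMod q)),
      IsSTPP A' B' C' ∧ ∀ x, (A' x).card = N ^ n ∧ (B' x).card = M ^ n ∧ (C' x).card = N ^ n := by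
  have hcA : ∀ i, (A i).card = N := fun i => (hc i).1
  have hcB : ∀ i, (B i).card = M := fun i => (hc i).2.1
  have hcC : ∀ i, (C i).card = N := fun i => (hc i).2.2
  refine ⟨_, _, _, isSTPP_taggedPower hW hR hq
    (fun x : Fin (L ^ n) => (finFunctionFinEquiv (m := L) (n := n)).symm x)
    (finFunctionFinEquiv (m := L) (n := n)).symm.injective, fun x => ?_⟩
  simp [Fintype.card_piFinset, hcA, hcB, hcC]

/-- **Explicit exponent.**  For `r > 1` the even exponent `n = 2m`, `m := ⌈8R/(r−1)²⌉₊ + 1`, has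
`1 ≤ n` and `4nR + 1 ≤ rⁿ`: with `a = r − 1 > 0`, `m a² ≥ 8R`, so
`rⁿ = ((1+a)^m)² ≥ (1 + m a)² ≥ 1 + m² a² ≥ 1 + 8mR = 4nR + 1` (Bernoulli). [folklore] -/
theorem exists_tagModulus_le_pow {r : ℝ} (hr : 1 < r) (R : ℕ) :
    ∃ n : ℕ, 1 ≤ n ∧ ((4 * n * R + 1 : ℕ) : ℝ) ≤ r ^ n := by
  set m : ℕ := ⌈8 * (R : ℝ) / (r - 1) ^ 2⌉₊ + 1 with hm
  refine ⟨2 * m, by omega, ?_⟩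
  have ha : 0 < r - 1 := sub_pos.mpr hr
  have ha2 : 0 < (r - 1) ^ 2 := by positivity
  have hm1 : 8 * (R : ℝ) / (r - 1) ^ 2 ≤ m := by
    rw [hm]; push_cast
    linarith [Nat.le_ceil (8 * (R : ℝ) / (r - 1) ^ 2)]
  have hma : 8 * (R : ℝ) ≤ m * (r - 1) ^ 2 := by rwa [div_le_iff₀ ha2] at hm1
  have hm0 : (0 : ℝ) ≤ m := Nat.cast_nonneg _
  have hB : 1 + (m : ℝ) * (r - 1) ≤ (1 + (r - 1)) ^ m := one_add_mul_le_pow (by linarith) m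
  have h1r : 1 + (r - 1) = r := by ring
  rw [h1r] at hB
  have hma0 : (0 : ℝ) ≤ 1 + m * (r - 1) := by nlinarith [mul_nonneg hm0 ha.le]
  calc ((4 * (2 * m) * R + 1 : ℕ) : ℝ) = 1 + (m : ℝ) * (8 * R) := by push_cast; ring
    _ ≤ 1 + (m : ℝ) * (m * (r - 1) ^ 2) := by gcongr
    _ ≤ (1 + m * (r - 1)) ^ 2 := by nlinarith [mul_nonneg hm0 ha.le]
    _ ≤ (r ^ m) ^ 2 := pow_le_pow_left₀ hma0 hB 2
    _ = r ^ (2 * m) := by rw [← pow_mul, mul_comm]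

/-- **`GeneralFrameDesigns → ThinPackings`** (registered stub `thinPackings_of_generalFrameDesigns` of crux
stmt-MatrixMultiplication-10595, proved by potential tagging).  Orthogonal frames `A B C : Fin L →
Finset (Fin D → ℤ)` on spheres of arbitrary per-block squared radii `rA, rB, rC`, in the box `[-b, b]^D`,
with order-compatible integer potentials `κ, μ` bounded by `R`, the three packings and the distinct-label
clause on the triples of non-positive weight, blocks `⟨N, M, N⟩` with `N ≥ 2`, `N^a ≤ M`, and
`(6b+1)^D ≤ L·N^{2+η}` — available for every `a < 1`, `η > 0` — give the crux `ThinPackings`.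
Explicit witness at `(a, η)`: the design at slack `η/2`, reduced modulo `6b+1`, its `n`-th power
(`n = 2(⌈8R/(N^{η/2}−1)²⌉+1)`) tagged in `(Fin n → Fin D → ZMod (6b+1)) × ZMod (4nR+1)`: all `Lⁿ`
product blocks `⟨Nⁿ, Mⁿ, Nⁿ⟩`, and `(6b+1)^{Dn}(4nR+1) ≤ Lⁿ (Nⁿ)^{2+η}`.
[new, elementary; cf. `Theorems.ThinPackings.thinPackings_of_generalFrameDesigns` (popular-class route)] -/
theorem thinPackings_of_generalFrameDesigns :
    (∀ a : ℝ, 0 ≤ a → a < 1 → ∀ η : ℝ, 0 < η →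
      ∃ (D L N M b R : ℕ) (A B C : Fin L → Finset (Fin D → ℤ)) (rA rB rC κ μ : Fin L → ℤ),
        ((∀ i, ∀ x ∈ A i, ∀ y ∈ B i, x ⬝ᵥ y = 0) ∧ (∀ i, ∀ x ∈ A i, ∀ z ∈ C i, x ⬝ᵥ z = 0) ∧
          (∀ i, ∀ y ∈ B i, ∀ z ∈ C i, y ⬝ᵥ z = 0)) ∧
        ((∀ i, ∀ x ∈ A i, x ⬝ᵥ x = rA i) ∧ (∀ i, ∀ y ∈ B i, y ⬝ᵥ y = rB i) ∧
          (∀ i, ∀ z ∈ C i, z ⬝ᵥ z = rC i)) ∧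
        ((∀ i k, rA k + rB k < rA i + rB i → κ k + 1 ≤ κ i) ∧
          (∀ i k, rB k + rC k < rB i + rC i → μ k + 1 ≤ μ i) ∧
          (∀ i k, rA i + rC i < rA k + rC k → κ k + μ k + 1 ≤ κ i + μ i)) ∧
        ((∀ i k, ∀ a ∈ A i, ∀ c ∈ C i, ∀ a' ∈ A k, ∀ c' ∈ C k, c - a = c' - a' → i = k ∧ a = a' ∧ c = c') ∧
         (∀ i k, ∀ a ∈ A i, ∀ b ∈ B i, ∀ a' ∈ A k, ∀ b' ∈ B k, b - a = b' - a' → i = k ∧ a = a' ∧ b = b') ∧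
         (∀ i k, ∀ b ∈ B i, ∀ c ∈ C i, ∀ b' ∈ B k, ∀ c' ∈ C k, b - c = b' - c' → i = k ∧ b = b' ∧ c = c') ∧
         (∀ i j k : Fin L, i ≠ j → j ≠ k → i ≠ k → (κ i - κ k) + (μ j - μ k) ≤ 0 →
            ∀ s ∈ A k, ∀ s' ∈ A i, ∀ t ∈ B i, ∀ t' ∈ B j, ∀ u ∈ C j, ∀ u' ∈ C k,
              (s' - s) + (t' - t) + (u' - u) ≠ 0)) ∧
        (∀ i, (A i).card = N ∧ (B i).card = M ∧ (C i).card = N) ∧ 2 ≤ N ∧ (N : ℝ) ^ a ≤ M ∧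
        (∀ i, (∀ v ∈ A i, ∀ t, |v t| ≤ (b : ℤ)) ∧ (∀ v ∈ B i, ∀ t, |v t| ≤ (b : ℤ)) ∧
          (∀ v ∈ C i, ∀ t, |v t| ≤ (b : ℤ))) ∧
        (∀ i, |κ i| ≤ (R : ℤ) ∧ |μ i| ≤ (R : ℤ)) ∧
        (((6 * b + 1 : ℕ) : ℝ)) ^ D ≤ L * (N : ℝ) ^ (2 + η)) →
    ThinPackings := by
  intro hF a ha0 ha1 η hη
  -- the design at slack η/2
  obtain ⟨D, L, N, M, b, R, A, B, C, rA, rB, rC, κ, μ, hfr, hsph, hoc, hres, hc, hN, hM, hbox, hR,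
    hcount⟩ := hF a ha0 ha1 (η / 2) (by positivity)
  have hN1 : (1 : ℝ) < N := by exact_mod_cast (by omega : 1 < N)
  have hNpos : (0 : ℝ) < N := by linarith
  have hN0 : (0 : ℝ) ≤ N := hNpos.le
  -- frames with order-compatible potentials are label-weighted (Pythagoras bridge)
  have hLW : IsLabelWeightedSTPP A B C κ μ :=
    (stub_generalBridge D L A B C rA rB rC κ μ hfr hsph hoc).2 hres
  -- reduction modulo 6b+1 > 6b keeps the weighted family and the cardinalities
  obtain ⟨hLW', hc'⟩ := stub_boxFreiman D L b (6 * b + 1) A B C κ μ (by omega) hbox hLW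
  have hc₁ : ∀ i, ((A i).image (fun (v : Fin D → ℤ) (t : Fin D) => (v t : ZMod (6 * b + 1)))).card = N ∧
      ((B i).image (fun (v : Fin D → ℤ) (t : Fin D) => (v t : ZMod (6 * b + 1)))).card = M ∧
      ((C i).image (fun (v : Fin D → ℤ) (t : Fin D) => (v t : ZMod (6 * b + 1)))).card = N := by
    intro i
    obtain ⟨h1, h2, h3⟩ := hc' i
    obtain ⟨g1, g2, g3⟩ := hc i
    exact ⟨h1.trans g1, h2.trans g2, h3.trans g3⟩
  -- the explicit exponent: 4nR+1 ≤ N^{nη/2}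
  have hr1 : 1 < (N : ℝ) ^ (η / 2) := Real.one_lt_rpow hN1 (by positivity)
  obtain ⟨n, hn1, hq⟩ := exists_tagModulus_le_pow hr1 R
  -- the tagged n-th power
  obtain ⟨A', B', C', hS, hcard'⟩ :=
    exists_isSTPP_tagged hLW' hc₁ hR n (q := 4 * n * R + 1) (Nat.lt_succ_self _)
  refine ⟨(Fin n → (Fin D → ZMod (6 * b + 1))) × ZMod (4 * n * R + 1), inferInstance, inferInstance,
    L ^ n, N ^ n, M ^ n, A', B', C', hS, hcard', ?_, ?_, ?_⟩
  · -- 2 ≤ N ^ n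
    calc 2 ≤ N := hN
      _ = N ^ 1 := (pow_one N).symm
      _ ≤ N ^ n := Nat.pow_le_pow_right (by omega) hn1
  · -- (N^n)^a ≤ M^n
    have h0 : (0 : ℝ) ≤ (N : ℝ) ^ a := by positivity
    push_cast
    rw [← Real.rpow_natCast_mul hN0, mul_comm, Real.rpow_mul_natCast hN0]
    exact pow_le_pow_left₀ h0 hM n
  · -- the packing count: (6b+1)^{Dn} (4nR+1) ≤ L^n (N^n)^{2+η}
    have hsplit : (N : ℝ) ^ (2 + η / 2) * (N : ℝ) ^ (η / 2) = (N : ℝ) ^ (2 + η) := by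
      rw [← Real.rpow_add hNpos]
      congr 1
      ring
    have hpow : ((N : ℝ) ^ (2 + η)) ^ n = (((N ^ n : ℕ) : ℝ)) ^ (2 + η) := by
      push_cast
      rw [← Real.rpow_mul_natCast hN0, mul_comm, Real.rpow_natCast_mul hN0]
    have hX0 : (0 : ℝ) ≤ (((6 * b + 1 : ℕ) : ℝ)) ^ D := by positivity
    have hq0 : (0 : ℝ) ≤ ((4 * n * R + 1 : ℕ) : ℝ) := Nat.cast_nonneg _
    have hLN0 : (0 : ℝ) ≤ ((L : ℝ) * (N : ℝ) ^ (2 + η / 2)) ^ n := by positivity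
    have key : ((((6 * b + 1 : ℕ) : ℝ)) ^ D) ^ n * ((4 * n * R + 1 : ℕ) : ℝ) ≤
        ((L ^ n : ℕ) : ℝ) * (((N ^ n : ℕ) : ℝ)) ^ (2 + η) :=
      calc ((((6 * b + 1 : ℕ) : ℝ)) ^ D) ^ n * ((4 * n * R + 1 : ℕ) : ℝ)
          ≤ ((L : ℝ) * (N : ℝ) ^ (2 + η / 2)) ^ n * ((N : ℝ) ^ (η / 2)) ^ n :=
            mul_le_mul (pow_le_pow_left₀ hX0 hcount n) hq hq0 hLN0
        _ = (L : ℝ) ^ n * (((N : ℝ) ^ (2 + η / 2) * (N : ℝ) ^ (η / 2)) ^ n) := by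
            rw [mul_pow, mul_pow]; ring
        _ = (L : ℝ) ^ n * ((N : ℝ) ^ (2 + η)) ^ n := by rw [hsplit]
        _ = ((L ^ n : ℕ) : ℝ) * (((N ^ n : ℕ) : ℝ)) ^ (2 + η) := by rw [hpow]; push_cast; ring
    have hcardG : Fintype.card ((Fin n → (Fin D → ZMod (6 * b + 1))) × ZMod (4 * n * R + 1)) =
        ((6 * b + 1) ^ D) ^ n * (4 * n * R + 1) := by
      simp only [Fintype.card_prod, Fintype.card_fun, Fintype.card_fin, ZMod.card]
    rw [hcardG]
    push_cast at key ⊢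
    exact key

end Summit.MatrixMultiplication.MatrixMultiplication.Theorems.ThinPackings.Tagged
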